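import Mathlib
import Summits.MatrixMultiplication.MatrixMultiplication.Theses.SnSubsetDichotomy
import Summits.MatrixMultiplication.MatrixMultiplication.Theorems.SnSubsetDichotomyUmvirateDescent

/-!
# `SnSubsetDichotomy.JuntaBranch`, line `envelope-stability` — stub `stub_cash`

CASHING a gaining common-target block (crux stmt-MatrixMultiplication-8304, registered stub
`stub_cash` of `Cruxes/JuntaBranch/Lines/envelope_stability.lean`).

## Statement

For a triple `S, T, U ⊆ S_n` with the triple product property, a level `1 ≤ t ≤ √n` and injective
`t`-tuples `L` (common target) and `I, J, P` (sources): if the common-target block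
`(I → L, J → L, P → L)` gains the factor `e^{c+1}` in normalised volume, i.e.
`e^{c+1} · |S||T||U| · ((n-t)!/n!)^{3/2} ≤ |S ∩ U_{I→L}| · |T ∩ U_{J→L}| · |U ∩ U_{P→L}|`, then there is
a level `n'` with `n - √n ≤ n' < n` and a TPP triple `S', T', U' ⊆ S_{n'}` with
`e^{c+1} · |S||T||U| · (n'!/n!)^{3/2} ≤ |S'||T'||U'|`.

## Proof sketch

Pure bookkeeping.  Take `n' := n - t`.  The route item `UmvirateDescent`
(stmt-MatrixMultiplication-8308, tree theorem `umvirateDescent_proof`) produces a TPP triple of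
`S_{n-t}` with exactly the three atom cardinalities, so the required volume inequality is the gain
hypothesis verbatim (`n'! = (n-t)!`).  Window arithmetic: `1 ≤ t ≤ √n` forces `1 ≤ n`, hence
`√n ≤ n` and `t ≤ n`, so `((n - t : ℕ) : ℝ) = n - t ≥ n - √n` (`Nat.cast_sub`) and `n - t < n`
(`Nat.sub_lt`).

Sources: BlasiakChurchCohnGrochowUmans2017 (proof of Thm. 4.2, the descent); Mathlib
(`Real.sqrt_le_left`, `Real.sqrt_nonneg`, `Nat.cast_sub`, `Nat.sub_lt`).
-/

set_option linter.dupNamespace false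

open Literature.Combinatorics.Additive
open Summit.MatrixMultiplication.MatrixMultiplication.Theses.SnSubsetDichotomy
open scoped Classical

namespace Summit.MatrixMultiplication.MatrixMultiplication.Theorems.JuntaBranch

/-- **stub_cash** (CASHING a gaining block = `UmvirateDescent` + window arithmetic).
If the common-target block `(I→L, J→L, P→L)` of level `1 ≤ t ≤ √n` of a TPP triple `S, T, U ⊆ S_n`
gains the factor `e^{c+1}` in normalised volume, then the crux's conclusion holds with `n' = n - t`:
route item `UmvirateDescent` (stmt-MatrixMultiplication-8308) gives a TPP triple of `S_{n-t}` with
exactly the three atom cardinalities, `n - √n ≤ n - t < n`, and the gain hypothesis is literally the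
required inequality (`(n-t)! = n'!`).  No density hypothesis, every `n`. -/
theorem stub_cash :
    ∀ (n : ℕ) (c : ℝ) (S T U : Finset (Equiv.Perm (Fin n))), TripleProductProperty S T U →
    ∀ t : ℕ, 1 ≤ t → (t : ℝ) ≤ Real.sqrt (n : ℝ) → ∀ L I J P : Fin t → Fin n,
      Function.Injective L → Function.Injective I → Function.Injective J → Function.Injective P →
      Real.exp (c + 1) * ((S.card * T.card * U.card : ℕ) : ℝ) *
          ((((n - t).factorial : ℕ) : ℝ) / (n.factorial : ℝ)) ^ ((3 : ℝ) / 2) ≤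
        (((S.filter (fun σ => ∀ k, σ (I k) = L k)).card *
            (T.filter (fun σ => ∀ k, σ (J k) = L k)).card *
            (U.filter (fun σ => ∀ k, σ (P k) = L k)).card : ℕ) : ℝ) →
      ∃ n' : ℕ, (n : ℝ) - Real.sqrt (n : ℝ) ≤ (n' : ℝ) ∧ n' < n ∧
        ∃ S' T' U' : Finset (Equiv.Perm (Fin n')), TripleProductProperty S' T' U' ∧
          Real.exp (c + 1) * ((S.card * T.card * U.card : ℕ) : ℝ) *
              ((n'.factorial : ℝ) / (n.factorial : ℝ)) ^ ((3 : ℝ) / 2) ≤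
            ((S'.card * T'.card * U'.card : ℕ) : ℝ) := by
  intro n c S T U hTPP t ht hts L I J P hL hI hJ hP hgain
  -- window arithmetic: `1 ≤ t ≤ √n` forces `1 ≤ n`, hence `√n ≤ n` and `t ≤ n`
  have ht1 : (1 : ℝ) ≤ (t : ℝ) := by exact_mod_cast ht
  have hn0 : (0 : ℝ) ≤ (n : ℝ) := Nat.cast_nonneg n
  have hn1 : (1 : ℝ) ≤ (n : ℝ) := by
    have h1 : (1 : ℝ) ≤ Real.sqrt (n : ℝ) := le_trans ht1 hts
    have h2 : Real.sqrt (n : ℝ) * Real.sqrt (n : ℝ) = (n : ℝ) := Real.mul_self_sqrt hn0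
    nlinarith [h1, h2]
  have hsqrt_le : Real.sqrt (n : ℝ) ≤ (n : ℝ) := by
    rw [Real.sqrt_le_left hn0]
    nlinarith [hn1]
  have htn_real : (t : ℝ) ≤ (n : ℝ) := le_trans hts hsqrt_le
  have htn : t ≤ n := by exact_mod_cast htn_real
  have hn_pos : 0 < n := by
    have : (0 : ℝ) < (n : ℝ) := lt_of_lt_of_le one_pos hn1
    exact_mod_cast this
  -- the descent: a TPP triple of `S_{n-t}` with exactly the three atom cardinalities
  obtain ⟨S', T', U', hTPP', hS', hT', hU'⟩ :=
    umvirateDescent_proof n t htn I J P L hI hJ hP hL S T U hTPP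
  refine ⟨n - t, ?_, Nat.sub_lt hn_pos ht, S', T', U', hTPP', ?_⟩
  · rw [Nat.cast_sub htn]
    linarith [hts]
  · rw [hS', hT', hU']
    exact hgain

end Summit.MatrixMultiplication.MatrixMultiplication.Theorems.JuntaBranch
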